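/-
Copyright (c) 2026. All rights reserved.
Released under Apache 2.0 license as described in the file LICENSE.
Authors: abc-iut cell, seat abc-iut-w5-d053 (gen 4; row «COR37-LOGOBS-GLUE») over abc-iut-L4-t5's model inputs.
-/
import Literature.AnabelianGeometry.AbsoluteAnabelian.AbsTopIII.BiAnabelianLogGlueFamily
import Literature.AnabelianGeometry.AbsoluteAnabelian.AbsTopIII.MLFLogFrobeniusIotaOverGalois
import HarnessLib

/-!
# [AbsTopIII] Cor 3.7 (iii), second clause (cores part) AT THE MLF MODEL — zero displayed hypotheses

S. Mochizuki, *Topics in absolute anabelian geometry III* [MochizukiAbsTopIII2015] (kurims manuscript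
`paper:url-5493eb38cbb7`), Cor 3.7 (iii) p. 88; Def 3.1 (iv) p. 69 (`ι_×`, `ι_log` are the identity on `Π`).

PROOF-ONLY: `logObsCompatCoresStmt_of_iotaOverGal` (`BiAnabelianLogGlueFamily.lean`) at abc-iut-L4-t9 lineage's
model `TFModel.modelSetting p` of the input structure of Cor 3.7, where the two displayed hypotheses (H×), (Hlog)
are abc-iut-L4-t5's `modelSetting_iotaTimes_overGal` / `modelSetting_iotaLog_overGal` (p447746).  HONEST FRAMING:
model-level ≠ node-level; nothing here bears on [IUTchIII] Cor. 3.12.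
-/

set_option autoImplicit false

namespace Literature.AnabelianGeometry.AbsoluteAnabelian.AbsTopIII

namespace TFModel

variable (p : ℕ) [Fact p.Prime]

/-- **Cor 3.7 (iii), second clause — cores part, at the MLF model, unconditionally**: ONE family of homotopies on
`𝒟*` (the glued family at `ι` over Galois) contains the `𝔖†_log` family and the core structures of (i), (ii).
[cite: MochizukiAbsTopIII2015, Cor 3.7 (iii) p.88] -/
theorem modelSetting_logObsCompatCoresStmt :
    Literature.AnabelianGeometry.AbsoluteAnabelian.AbsTopIII.BiAnabelianSetting.LogObsCompatCoresStmt
      (modelSetting p) :=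
  (modelSetting p).logObsCompatCoresStmt_of_iotaOverGal (modelSetting_iotaTimes_overGal p)
    (modelSetting_iotaLog_overGal p)

/-- The realising family, by name: the glued family of the model at `ι` over Galois realises the cores AND `𝔖†_log`.
[cite: MochizukiAbsTopIII2015, Cor 3.7 (iii) p.88] -/
theorem modelSetting_realisesCoresAndLogObs :
    (modelSetting p).RealisesCoresAndLogObs
      ((modelSetting p).glueLogFamily (modelSetting_iotaTimes_overGal p) (modelSetting_iotaLog_overGal p)) :=
  (modelSetting p).realisesCoresAndLogObs_glueLogFamily _ _

end TFModel

end Literature.AnabelianGeometry.AbsoluteAnabelian.AbsTopIII
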